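import Literature.Analysis.FluidPDE.CoordDerivatives
import Literature.Analysis.FluidPDE.WholeSpaceIBP
import HarnessLib

/-!
# The weighted energy identity for the frozen-time wave system `(u, X)` on `ℝ³`

Analysis/PDE support file (everything proved, no named facts). It is the spatial, frozen-time
half of the energy estimate for second-order hyperbolic equations
`∑_{μν} ∂_μ (G^{μν} ∂_ν u) = 0` on `ℝ × ℝ³` written as a first-order system in `(u, X)`,
`X = G^{00} ∂ₜu + ∑ⱼ G^{0j} ∂ⱼu` the momentum conjugate to the slices `{t = const}`
(S. Alinhac, *Hyperbolic Partial Differential Equations* (2009), Ch. 6–7: the energy inequality by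
the multiplier `∂ₜ`-type method, Thm. 6.3 / Thm. 7.8, here for the normal momentum; L. Hörmander,
*Lectures on Nonlinear Hyperbolic Differential Equations* (1997), §6.3, Lemma 6.3.3).

With frozen coefficients `a = −G^{00} > 0`, `bᵢ = G^{0i}`, `gᵢⱼ = G^{ij} = gⱼᵢ` (`SliceCoeff`) the
system reads `∂ₜ u = V`, `∂ₜ X = D` with

  `V = vel u X = (∑ⱼ bⱼ ∂ⱼu − X) / a`,   `Wᵢ = flux u X i = bᵢ V + ∑ⱼ gᵢⱼ ∂ⱼu`,
  `D = divFlux u X = −∑ᵢ ∂ᵢ Wᵢ`,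

and the energy density is `½ X² + ½ ∑ᵢⱼ 𝔅ᵢⱼ ∂ᵢu ∂ⱼu`, `𝔅 = a g + b ⊗ b` (`bform`; positive
definite exactly when the slices are spacelike), whose polarisation is
`epair u X u' X' = X X' + ∑ 𝔅ᵢⱼ ∂ᵢu ∂ⱼu'`. The main result is the **weighted energy identity**
(`integral_mul_epair_vel_divFlux_eq`): for smooth `u, X` and a smooth compactly supported weight
`ψ`,

  `∫ ψ · epair u X (vel u X) (divFlux u X) = ∫ lowerOrder ψ u X`,

where `lowerOrder` is an explicit quadratic expression in `(X, V, ∂u)` whose coefficients are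
products of `ψ, ∂ψ, a, ∂a, b, ∂b, g, ∂g` — i.e. the time derivative of the `ψ`-weighted energy
along the frozen system contains **no second derivatives of `u` and no derivatives of `X`**:
they are total divergences. Proof: the pointwise identity `ψ · epair = div(…) + lowerOrder`
(`mul_epair_vel_divFlux_eq`), by the product rule and three cancellations — (α)
`∑ gᵢⱼ (∂ᵢu ∂ⱼV − ∂ⱼu ∂ᵢV) = 0`; (β) `∑ bᵢbⱼ (V ∂ᵢⱼu + ∂ᵢu ∂ⱼV) = ∑ⱼ bⱼ ∂ⱼ(V S)` up to lower
order, `S = ∑ bᵢ∂ᵢu`; (γ) `∑ₖ bₖ ∑ gᵢⱼ ∂ₖᵢu ∂ⱼu = ½ ∑ₖ bₖ ∂ₖ(∑ gᵢⱼ∂ᵢu∂ⱼu)` up to lower order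
(symmetry of `g` and of `D²u`) — followed by `∫ ∂ᵢ(compactly supported) = 0`. The bound
`|lowerOrder| ≤ C (X² + |∂u|²) 𝟙_{supp ψ}` with `C` explicit in the sup norms of the coefficients
is `abs_lowerOrder_le`. This identity, applied to mollified pairs, is the engine of the
uniform energy estimate for the regularised evolution of the next files (Alinhac 2009,
Thm. 7.11, Step 2 (c)).

Dimension three is fixed (`EuclideanSpace ℝ (Fin 3)`; the pointwise identity is verified by
expanding the finite sums), which is what the application (wave equations on `ℝ^{1+3}`) needs.

## Mathlib / tree search

Tree: `FluidPDE/CoordDerivatives` (`pderiv`, product rules, Schwarz `pderiv_comm`),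
`FluidPDE/WholeSpaceIBP` (`integral_fderiv_apply_eq_zero`: `∫ ∂ᵥh = 0` for `h ∈ C¹_c`). The tree's
`Geometry/Lorentzian/KerrSchildEnergyCurrent` proves the space–time divergence identity
`∑_μ ∂_μ T^{μ0} = (□u) X + R` for functions on `E4`; the present frozen-time form in the variables
`(u, X)` on `ℝ³` (no time derivatives, arbitrary `X`) is what the regularised evolution needs and is
not derivable from it without re-differentiating. Mathlib: no hyperbolic energy identities.

## References

* S. Alinhac, *Hyperbolic Partial Differential Equations*, Springer (2009), §6.2 (Thm. 6.3),
  §7.3 (Thm. 7.8), §7.6 (Thm. 7.11, Step 2 (c)). [`AlinhacHPDE2009`]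
* L. Hörmander, *Lectures on Nonlinear Hyperbolic Differential Equations*, Springer (1997), §6.3,
  Lemma 6.3.3 and (6.3.5)–(6.3.7). [`Hormander1997`]
-/

noncomputable section

open MeasureTheory Set Function Filter Finset
open scoped BigOperators ContDiff Topology

namespace Literature.Analysis.PDE

open Literature.Analysis.FluidPDE

/-- Euclidean `3`-space (local notation). -/
local notation "𝔼" => EuclideanSpace ℝ (Fin 3)

/-! ### Frozen-time coefficients and the first-order system -/

/-- **Frozen-time coefficients** of a second-order hyperbolic operator `∑ ∂_μ G^{μν} ∂_ν` on
`ℝ × ℝ³` at a fixed time: `a = −G^{00} > 0`, `bᵢ = G^{0i}`, `gᵢⱼ = G^{ij}` symmetric, all smooth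
on `ℝ³` (Hörmander 1997, §6.3, (6.3.2): `g^{00} > 0` in his signature convention, `g^{jk}`
symmetric). [cite: Hormander1997, §6.3 (6.3.2)] -/
structure SliceCoeff where
  /-- `a = −G^{00}`. -/
  a : EuclideanSpace ℝ (Fin 3) → ℝ
  /-- `bᵢ = G^{0i} = G^{i0}`. -/
  b : Fin 3 → EuclideanSpace ℝ (Fin 3) → ℝ
  /-- `gᵢⱼ = G^{ij}`. -/
  g : Fin 3 → Fin 3 → EuclideanSpace ℝ (Fin 3) → ℝ
  /-- `g` is symmetric. -/
  g_symm : ∀ i j, g i j = g j i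
  /-- `a > 0` (the slices are non-characteristic). -/
  a_pos : ∀ x, 0 < a x
  /-- smoothness -/
  contDiff_a : ContDiff ℝ ∞ a
  /-- smoothness -/
  contDiff_b : ∀ i, ContDiff ℝ ∞ (b i)
  /-- smoothness -/
  contDiff_g : ∀ i j, ContDiff ℝ ∞ (g i j)

namespace SliceCoeff

variable (c : SliceCoeff)

/-- The quadratic form of the energy, `𝔅ᵢⱼ = a gᵢⱼ + bᵢ bⱼ` (`= −G^{00}G^{ij} + G^{0i}G^{0j}`,
`−G^{00}` times the inverse induced metric of the slice). [cite: Hormander1997, §6.3 Lemma 6.3.3] -/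
def bform (i j : Fin 3) (x : 𝔼) : ℝ := c.a x * c.g i j x + c.b i x * c.b j x

/-- `𝔅` is symmetric. [folklore] -/
theorem bform_symm (i j : Fin 3) (x : 𝔼) : c.bform i j x = c.bform j i x := by
  unfold bform; rw [c.g_symm i j]; ring

/-- The tangential momentum `S = ∑ᵢ bᵢ ∂ᵢu`. [folklore] -/
def bgrad (u : 𝔼 → ℝ) (x : 𝔼) : ℝ := ∑ i, c.b i x * pderiv i u x

/-- The **velocity** `V = ∂ₜu` recovered from `(u, X)`: `V = (∑ⱼ bⱼ∂ⱼu − X)/a`, i.e.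
`X = −a V + ∑ⱼ bⱼ ∂ⱼu = G^{00}∂ₜu + G^{0j}∂ⱼu`. [cite: Hormander1997, §6.3 (6.3.5)] -/
def vel (u X : 𝔼 → ℝ) (x : 𝔼) : ℝ := (c.bgrad u x - X x) / c.a x

/-- The **flux** `Wᵢ = bᵢ V + ∑ⱼ gᵢⱼ ∂ⱼu = G^{i0}∂ₜu + G^{ij}∂ⱼu`. [cite: Hormander1997, §6.3 (6.3.5)] -/
def flux (u X : 𝔼 → ℝ) (i : Fin 3) (x : 𝔼) : ℝ :=
  c.b i x * c.vel u X x + ∑ j, c.g i j x * pderiv j u x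

/-- The **time derivative of `X`** dictated by the equation `∂ₜX + ∑ᵢ ∂ᵢWᵢ = 0`:
`D = −∑ᵢ ∂ᵢ Wᵢ`. [cite: Hormander1997, §6.3 (6.3.5)] -/
def divFlux (u X : 𝔼 → ℝ) (x : 𝔼) : ℝ := -∑ i, pderiv i (c.flux u X i) x

/-- The quadratic form `Q = ∑ᵢⱼ gᵢⱼ ∂ᵢu ∂ⱼu`. [folklore] -/
def gquad (u : 𝔼 → ℝ) (x : 𝔼) : ℝ := ∑ i, ∑ j, c.g i j x * pderiv i u x * pderiv j u x

/-- The **polarised energy density** `epair u X u' X' = X X' + ∑ᵢⱼ 𝔅ᵢⱼ ∂ᵢu ∂ⱼu'` (the second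
pair is the one whose `u` is differentiated in the slot `j`). [cite: Hormander1997, §6.3 Lemma 6.3.3] -/
def epair (u X u' X' : 𝔼 → ℝ) (x : 𝔼) : ℝ :=
  X x * X' x + ∑ i, ∑ j, c.bform i j x * pderiv i u x * pderiv j u' x

/-- The **energy density** `½ X² + ½ ∑ 𝔅ᵢⱼ ∂ᵢu ∂ⱼu`. [cite: Hormander1997, §6.3 Lemma 6.3.3] -/
def edens (u X : 𝔼 → ℝ) (x : 𝔼) : ℝ := 2⁻¹ * c.epair u X u X x

/-! ### Smoothness -/

variable {c}

/-- `a ≠ 0`. [folklore] -/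
theorem a_ne_zero (c : SliceCoeff) (x : 𝔼) : c.a x ≠ 0 := (c.a_pos x).ne'

/-- `bform` is smooth. [folklore] -/
theorem contDiff_bform (c : SliceCoeff) (i j : Fin 3) : ContDiff ℝ ∞ (c.bform i j) :=
  (c.contDiff_a.mul (c.contDiff_g i j)).add ((c.contDiff_b i).mul (c.contDiff_b j))

/-- `bgrad u` is smooth for smooth `u`. [folklore] -/
theorem contDiff_bgrad (c : SliceCoeff) {u : 𝔼 → ℝ} (hu : ContDiff ℝ ∞ u) :
    ContDiff ℝ ∞ (c.bgrad u) :=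
  ContDiff.sum fun i _ => (c.contDiff_b i).mul (contDiff_pderiv hu i)

/-- `vel u X` is smooth for smooth `u, X`. [folklore] -/
theorem contDiff_vel (c : SliceCoeff) {u X : 𝔼 → ℝ} (hu : ContDiff ℝ ∞ u) (hX : ContDiff ℝ ∞ X) :
    ContDiff ℝ ∞ (c.vel u X) :=
  ((contDiff_bgrad c hu).sub hX).div c.contDiff_a (a_ne_zero c)

/-- `flux u X i` is smooth. [folklore] -/
theorem contDiff_flux (c : SliceCoeff) {u X : 𝔼 → ℝ} (hu : ContDiff ℝ ∞ u) (hX : ContDiff ℝ ∞ X)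
    (i : Fin 3) : ContDiff ℝ ∞ (c.flux u X i) :=
  ((c.contDiff_b i).mul (contDiff_vel c hu hX)).add
    (ContDiff.sum fun j _ => (c.contDiff_g i j).mul (contDiff_pderiv hu j))

/-- `divFlux u X` is smooth. [folklore] -/
theorem contDiff_divFlux (c : SliceCoeff) {u X : 𝔼 → ℝ} (hu : ContDiff ℝ ∞ u)
    (hX : ContDiff ℝ ∞ X) : ContDiff ℝ ∞ (c.divFlux u X) :=
  (ContDiff.sum fun i _ => contDiff_pderiv (contDiff_flux c hu hX i) i).neg

/-- `gquad u` is smooth. [folklore] -/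
theorem contDiff_gquad (c : SliceCoeff) {u : 𝔼 → ℝ} (hu : ContDiff ℝ ∞ u) :
    ContDiff ℝ ∞ (c.gquad u) :=
  ContDiff.sum fun i _ => ContDiff.sum fun j _ =>
    ((c.contDiff_g i j).mul (contDiff_pderiv hu i)).mul (contDiff_pderiv hu j)

/-- `epair` is continuous for smooth arguments. [folklore] -/
theorem continuous_epair (c : SliceCoeff) {u X u' X' : 𝔼 → ℝ} (hu : ContDiff ℝ ∞ u)
    (hX : ContDiff ℝ ∞ X) (hu' : ContDiff ℝ ∞ u') (hX' : ContDiff ℝ ∞ X') :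
    Continuous (c.epair u X u' X') := by
  unfold epair
  refine (hX.continuous.mul hX'.continuous).add (continuous_finsetSum _ fun i _ =>
    continuous_finsetSum _ fun j _ => ?_)
  exact ((contDiff_bform c i j).continuous.mul (contDiff_pderiv hu i).continuous).mul
    (contDiff_pderiv hu' j).continuous

/-- **`X = S − a V`** (the definition of `V` solved for `X`). [folklore] -/
theorem X_eq_bgrad_sub (c : SliceCoeff) (u X : 𝔼 → ℝ) :
    X = fun x => c.bgrad u x - c.a x * c.vel u X x := by
  funext x
  unfold vel
  field_simp [a_ne_zero c x]
  ring

/-! ### The lower-order expression -/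

/-- **The lower-order part of the weighted energy derivative** (explicit): with `V = vel u X`,
`Wᵢ = flux u X i`, `S = bgrad u`, `Q = gquad u`,

`lowerOrder = ∑ᵢ (∂ᵢψ) X Wᵢ + ψ ∑ᵢ (∑ₖ (∂ᵢbₖ) ∂ₖu − (∂ᵢa) V) Wᵢ − ∑ⱼ ∂ⱼ(ψ bⱼ) V S
  − ψ V ∑ᵢⱼ bⱼ (∂ⱼbᵢ) ∂ᵢu + ½ ∑ᵢ ∂ᵢ(ψ a bᵢ) V² − ½ ∑ₖ ∂ₖ(ψ bₖ) Q − ½ ψ ∑ₖ bₖ ∑ᵢⱼ (∂ₖgᵢⱼ) ∂ᵢu ∂ⱼu`,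

a quadratic form in `(X, V, ∂u)` with coefficients built from `ψ, ∂ψ` and the coefficients and
their first derivatives. [cite: Hormander1997, §6.3 (6.3.6)–(6.3.7)] -/
def lowerOrder (c : SliceCoeff) (ψ u X : 𝔼 → ℝ) (x : 𝔼) : ℝ :=
  (∑ i, pderiv i ψ x * X x * c.flux u X i x) +
    ψ x * ∑ i, ((∑ k, pderiv i (c.b k) x * pderiv k u x) - pderiv i c.a x * c.vel u X x) *
      c.flux u X i x -
    (∑ j, pderiv j (fun y => ψ y * c.b j y) x) * (c.vel u X x * c.bgrad u x) -
    ψ x * c.vel u X x * (∑ i, ∑ j, c.b j x * pderiv j (c.b i) x * pderiv i u x) +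
    2⁻¹ * (∑ i, pderiv i (fun y => ψ y * c.a y * c.b i y) x) * c.vel u X x ^ 2 -
    2⁻¹ * (∑ k, pderiv k (fun y => ψ y * c.b k y) x) * c.gquad u x -
    2⁻¹ * ψ x * ∑ k, c.b k x * ∑ i, ∑ j, pderiv k (c.g i j) x * pderiv i u x * pderiv j u x

/-! ### Unfolding lemmas (value level) -/

/-- Unfolding `bgrad` at a point. [folklore] -/
theorem bgrad_apply (c : SliceCoeff) (u : 𝔼 → ℝ) (x : 𝔼) :
    c.bgrad u x = ∑ i, c.b i x * pderiv i u x := rfl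

/-- Unfolding `flux` at a point. [folklore] -/
theorem flux_apply (c : SliceCoeff) (u X : 𝔼 → ℝ) (i : Fin 3) (x : 𝔼) :
    c.flux u X i x = c.b i x * c.vel u X x + ∑ j, c.g i j x * pderiv j u x := rfl

/-- Unfolding `divFlux` at a point. [folklore] -/
theorem divFlux_apply (c : SliceCoeff) (u X : 𝔼 → ℝ) (x : 𝔼) :
    c.divFlux u X x = -∑ i, pderiv i (c.flux u X i) x := rfl

/-- Unfolding `gquad` at a point. [folklore] -/
theorem gquad_apply (c : SliceCoeff) (u : 𝔼 → ℝ) (x : 𝔼) :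
    c.gquad u x = ∑ i, ∑ j, c.g i j x * pderiv i u x * pderiv j u x := rfl

/-- Unfolding `epair` at a point. [folklore] -/
theorem epair_apply (c : SliceCoeff) (u X u' X' : 𝔼 → ℝ) (x : 𝔼) :
    c.epair u X u' X' x =
      X x * X' x + ∑ i, ∑ j, c.bform i j x * pderiv i u x * pderiv j u' x := rfl

/-- Unfolding `bform` at a point. [folklore] -/
theorem bform_apply (c : SliceCoeff) (i j : Fin 3) (x : 𝔼) :
    c.bform i j x = c.a x * c.g i j x + c.b i x * c.b j x := rfl

/-! ### The pointwise identity -/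

/-- **The pointwise weighted energy identity**: for smooth `ψ, u, X`,
`ψ · epair u X V D = −∑ᵢ ∂ᵢ(ψ X Wᵢ) + ∑ⱼ ∂ⱼ(ψ bⱼ V S) − ½ ∑ᵢ ∂ᵢ(ψ a bᵢ V²) + ½ ∑ₖ ∂ₖ(ψ bₖ Q)
  + lowerOrder ψ u X`
(`V = vel u X`, `D = divFlux u X`, `Wᵢ = flux u X i`, `S = bgrad u`, `Q = gquad u`): the principal
terms are total divergences. Proof: product rule throughout, `X = S − aV`, and the symmetry of
`g` and of the second derivatives of `u` (the three sums are expanded over `Fin 3` and the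
resulting polynomial identity is checked by `ring`). [cite: Hormander1997, §6.3 Lemma 6.3.3] -/
theorem mul_epair_vel_divFlux_eq (c : SliceCoeff) {ψ u X : 𝔼 → ℝ} (hψ : ContDiff ℝ ∞ ψ)
    (hu : ContDiff ℝ ∞ u) (hX : ContDiff ℝ ∞ X) (x : 𝔼) :
    ψ x * c.epair u X (c.vel u X) (c.divFlux u X) x =
      -(∑ i, pderiv i (fun y => ψ y * X y * c.flux u X i y) x) +
        (∑ j, pderiv j (fun y => ψ y * c.b j y * c.vel u X y * c.bgrad u y) x) -
        2⁻¹ * (∑ i, pderiv i (fun y => ψ y * c.a y * c.b i y * c.vel u X y ^ 2) x) +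
        2⁻¹ * (∑ k, pderiv k (fun y => ψ y * c.b k y * c.gquad u y) x) +
        c.lowerOrder ψ u X x := by
  have h1 : (1 : WithTop ℕ∞) ≠ 0 := one_ne_zero
  have hinf : (∞ : WithTop ℕ∞) ≠ 0 := by simp
  -- differentiability of all the players
  have dψ : Differentiable ℝ ψ := hψ.differentiable hinf
  have dXd : Differentiable ℝ X := hX.differentiable hinf
  have da : Differentiable ℝ c.a := c.contDiff_a.differentiable hinf
  have db : ∀ i, Differentiable ℝ (c.b i) := fun i => (c.contDiff_b i).differentiable hinf
  have dg : ∀ i j, Differentiable ℝ (c.g i j) := fun i j => (c.contDiff_g i j).differentiable hinf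
  have dp : ∀ i, Differentiable ℝ (pderiv i u) := fun i => (contDiff_pderiv hu i).differentiable hinf
  have dV : Differentiable ℝ (c.vel u X) := (contDiff_vel c hu hX).differentiable hinf
  have dS : Differentiable ℝ (c.bgrad u) := (contDiff_bgrad c hu).differentiable hinf
  have dW : ∀ i, Differentiable ℝ (c.flux u X i) := fun i =>
    (contDiff_flux c hu hX i).differentiable hinf
  have dQ : Differentiable ℝ (c.gquad u) := (contDiff_gquad c hu).differentiable hinf
  -- product-rule expansions (as equalities of functions)
  have hA : ∀ i, pderiv i (fun y => ψ y * X y * c.flux u X i y) = fun y =>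
      (pderiv i ψ y * X y + ψ y * pderiv i X y) * c.flux u X i y +
        ψ y * X y * pderiv i (c.flux u X i) y := by
    intro i
    rw [pderiv_mul (dψ.fun_mul dXd) (dW i), pderiv_mul dψ dXd]
  have hXfun : X = fun y => c.bgrad u y - c.a y * c.vel u X y := X_eq_bgrad_sub c u X
  have hdX : ∀ i y, pderiv i X y = pderiv i (c.bgrad u) y -
      (pderiv i c.a y * c.vel u X y + c.a y * pderiv i (c.vel u X) y) := by
    intro i y
    conv_lhs => rw [hXfun]
    rw [pderiv_sub dS (da.fun_mul dV), pderiv_mul da dV]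
  have hdS : ∀ i y, pderiv i (c.bgrad u) y =
      ∑ k, (pderiv i (c.b k) y * pderiv k u y + c.b k y * pderiv i (pderiv k u) y) := by
    intro i y
    have h : c.bgrad u = fun z => ∑ k, c.b k z * pderiv k u z := rfl
    rw [h, pderiv_sum (f := fun k z => c.b k z * pderiv k u z) univ (fun k _ => (db k).fun_mul (dp k))]
    exact Finset.sum_congr rfl fun k _ => by rw [pderiv_mul (db k) (dp k)]
  have hB : ∀ j, pderiv j (fun y => ψ y * c.b j y * c.vel u X y * c.bgrad u y) = fun y =>
      (pderiv j (fun z => ψ z * c.b j z) y * c.vel u X y +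
          ψ y * c.b j y * pderiv j (c.vel u X) y) * c.bgrad u y +
        ψ y * c.b j y * c.vel u X y * pderiv j (c.bgrad u) y := by
    intro j
    rw [pderiv_mul ((dψ.fun_mul (db j)).fun_mul dV) dS, pderiv_mul (dψ.fun_mul (db j)) dV]
  have hC : ∀ i, pderiv i (fun y => ψ y * c.a y * c.b i y * c.vel u X y ^ 2) = fun y =>
      pderiv i (fun z => ψ z * c.a z * c.b i z) y * c.vel u X y ^ 2 +
        ψ y * c.a y * c.b i y * (2 * c.vel u X y * pderiv i (c.vel u X) y) := by
    intro i
    rw [pderiv_mul ((dψ.fun_mul da).fun_mul (db i)) (dV.fun_pow 2), pderiv_pow dV 1]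
    funext y
    push_cast
    ring
  have hdQ : ∀ k y, pderiv k (c.gquad u) y =
      ∑ i, ∑ j, ((pderiv k (c.g i j) y * pderiv i u y + c.g i j y * pderiv k (pderiv i u) y) *
          pderiv j u y + c.g i j y * pderiv i u y * pderiv k (pderiv j u) y) := by
    intro k y
    have h : c.gquad u = fun z => ∑ i, ∑ j, c.g i j z * pderiv i u z * pderiv j u z := rfl
    rw [h, pderiv_sum (f := fun i z => ∑ j, c.g i j z * pderiv i u z * pderiv j u z) univ
      (fun i _ => Differentiable.fun_sum fun j _ => ((dg i j).fun_mul (dp i)).fun_mul (dp j))]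
    refine Finset.sum_congr rfl fun i _ => ?_
    rw [pderiv_sum (f := fun j z => c.g i j z * pderiv i u z * pderiv j u z) univ
      (fun j _ => ((dg i j).fun_mul (dp i)).fun_mul (dp j))]
    refine Finset.sum_congr rfl fun j _ => ?_
    rw [pderiv_mul ((dg i j).fun_mul (dp i)) (dp j), pderiv_mul (dg i j) (dp i)]
  have hD : ∀ k, pderiv k (fun y => ψ y * c.b k y * c.gquad u y) = fun y =>
      pderiv k (fun z => ψ z * c.b k z) y * c.gquad u y +
        ψ y * c.b k y * pderiv k (c.gquad u) y := by
    intro k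
    rw [pderiv_mul (dψ.fun_mul (db k)) dQ]
  -- symmetries at the point `x`
  have hg10 : c.g 1 0 x = c.g 0 1 x := congrFun (c.g_symm 1 0) x
  have hg20 : c.g 2 0 x = c.g 0 2 x := congrFun (c.g_symm 2 0) x
  have hg21 : c.g 2 1 x = c.g 1 2 x := congrFun (c.g_symm 2 1) x
  have hdg10 : ∀ k, pderiv k (c.g 1 0) x = pderiv k (c.g 0 1) x := fun k => by rw [c.g_symm 1 0]
  have hdg20 : ∀ k, pderiv k (c.g 2 0) x = pderiv k (c.g 0 2) x := fun k => by rw [c.g_symm 2 0]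
  have hdg21 : ∀ k, pderiv k (c.g 2 1) x = pderiv k (c.g 1 2) x := fun k => by rw [c.g_symm 2 1]
  have hH10 : pderiv 1 (pderiv 0 u) x = pderiv 0 (pderiv 1 u) x := congrFun (pderiv_comm hu 1 0) x
  have hH20 : pderiv 2 (pderiv 0 u) x = pderiv 0 (pderiv 2 u) x := congrFun (pderiv_comm hu 2 0) x
  have hH21 : pderiv 2 (pderiv 1 u) x = pderiv 1 (pderiv 2 u) x := congrFun (pderiv_comm hu 2 1) x
  have hXx : X x = c.bgrad u x - c.a x * c.vel u X x := congrFun hXfun x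
  -- expand everything at `x`
  simp only [hA, hB, hC, hD]
  simp only [hdX, hdS, hdQ]
  simp only [lowerOrder, epair_apply, bform_apply, divFlux_apply, flux_apply, gquad_apply]
  rw [hXx]
  simp only [bgrad_apply, Fin.sum_univ_three, hg10, hg20, hg21, hdg10, hdg20, hdg21, hH10, hH20,
    hH21]
  ring

/-! ### The integrated identity -/

/-- `∫ ∂ₗ F = 0` for a smooth compactly supported `F` (the tree's `integral_fderiv_apply_eq_zero`
in the coordinate direction `eₗ`). [folklore] -/
theorem integral_pderiv_eq_zero {F : 𝔼 → ℝ} (hF : ContDiff ℝ ∞ F) (hFc : HasCompactSupport F)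
    (l : Fin 3) : ∫ x, pderiv l F x = 0 :=
  integral_fderiv_apply_eq_zero (hF.of_le (by simp)) hFc (stdVec l)

/-- `∂ₗ F` is integrable for a smooth compactly supported `F`. [folklore] -/
theorem integrable_pderiv {F : 𝔼 → ℝ} (hF : ContDiff ℝ ∞ F) (hFc : HasCompactSupport F)
    (l : Fin 3) : Integrable (pderiv l F) :=
  (continuous_pderiv hF (by simp) l).integrable_of_hasCompactSupport (hFc.fderiv_apply ℝ _)

/-- **The weighted energy identity, integrated form**: for smooth `u, X` and a smooth compactly
supported weight `ψ`,
`∫ ψ · epair u X (vel u X) (divFlux u X) = ∫ lowerOrder ψ u X` — the pairing of the frozen-time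
evolution `(V, D)` with `(u, X)` in the `ψ`-weighted energy inner product is of lower order
(Hörmander 1997, §6.3, proof of Lemma 6.3.3 / (6.3.6): "integrating … the divergence terms
disappear"). [cite: Hormander1997, §6.3 Lemma 6.3.3] -/
theorem integral_mul_epair_vel_divFlux_eq (c : SliceCoeff) {ψ u X : 𝔼 → ℝ} (hψ : ContDiff ℝ ∞ ψ)
    (hψc : HasCompactSupport ψ) (hu : ContDiff ℝ ∞ u) (hX : ContDiff ℝ ∞ X) :
    ∫ x, ψ x * c.epair u X (c.vel u X) (c.divFlux u X) x = ∫ x, c.lowerOrder ψ u X x := by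
  -- the four families of compactly supported smooth potentials
  set FA : Fin 3 → 𝔼 → ℝ := fun i y => ψ y * X y * c.flux u X i y with hFA
  set FB : Fin 3 → 𝔼 → ℝ := fun j y => ψ y * c.b j y * c.vel u X y * c.bgrad u y with hFB
  set FC : Fin 3 → 𝔼 → ℝ := fun i y => ψ y * c.a y * c.b i y * c.vel u X y ^ 2 with hFC
  set FD : Fin 3 → 𝔼 → ℝ := fun k y => ψ y * c.b k y * c.gquad u y with hFD
  have sA : ∀ i, ContDiff ℝ ∞ (FA i) := fun i => (hψ.mul hX).mul (contDiff_flux c hu hX i)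
  have sB : ∀ j, ContDiff ℝ ∞ (FB j) := fun j =>
    ((hψ.mul (c.contDiff_b j)).mul (contDiff_vel c hu hX)).mul (contDiff_bgrad c hu)
  have sC : ∀ i, ContDiff ℝ ∞ (FC i) := fun i =>
    ((hψ.mul c.contDiff_a).mul (c.contDiff_b i)).mul ((contDiff_vel c hu hX).pow 2)
  have sD : ∀ k, ContDiff ℝ ∞ (FD k) := fun k => (hψ.mul (c.contDiff_b k)).mul (contDiff_gquad c hu)
  have cA : ∀ i, HasCompactSupport (FA i) := fun i => (hψc.mul_right).mul_right
  have cB : ∀ j, HasCompactSupport (FB j) := fun j => ((hψc.mul_right).mul_right).mul_right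
  have cC : ∀ i, HasCompactSupport (FC i) := fun i => ((hψc.mul_right).mul_right).mul_right
  have cD : ∀ k, HasCompactSupport (FD k) := fun k => (hψc.mul_right).mul_right
  -- the divergence part, its integrability and vanishing integral
  set Adiv : 𝔼 → ℝ := fun x => -(∑ i, pderiv i (FA i) x) + (∑ j, pderiv j (FB j) x) -
    2⁻¹ * (∑ i, pderiv i (FC i) x) + 2⁻¹ * (∑ k, pderiv k (FD k) x) with hAdiv
  have iA : Integrable (fun x => ∑ i, pderiv i (FA i) x) :=
    integrable_finsetSum _ fun i _ => integrable_pderiv (sA i) (cA i) i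
  have iB : Integrable (fun x => ∑ j, pderiv j (FB j) x) :=
    integrable_finsetSum _ fun j _ => integrable_pderiv (sB j) (cB j) j
  have iC : Integrable (fun x => ∑ i, pderiv i (FC i) x) :=
    integrable_finsetSum _ fun i _ => integrable_pderiv (sC i) (cC i) i
  have iD : Integrable (fun x => ∑ k, pderiv k (FD k) x) :=
    integrable_finsetSum _ fun k _ => integrable_pderiv (sD k) (cD k) k
  have zA : ∫ x, ∑ i, pderiv i (FA i) x = 0 := by
    rw [integral_finsetSum _ fun i _ => integrable_pderiv (sA i) (cA i) i]
    exact Finset.sum_eq_zero fun i _ => integral_pderiv_eq_zero (sA i) (cA i) i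
  have zB : ∫ x, ∑ j, pderiv j (FB j) x = 0 := by
    rw [integral_finsetSum _ fun j _ => integrable_pderiv (sB j) (cB j) j]
    exact Finset.sum_eq_zero fun j _ => integral_pderiv_eq_zero (sB j) (cB j) j
  have zC : ∫ x, ∑ i, pderiv i (FC i) x = 0 := by
    rw [integral_finsetSum _ fun i _ => integrable_pderiv (sC i) (cC i) i]
    exact Finset.sum_eq_zero fun i _ => integral_pderiv_eq_zero (sC i) (cC i) i
  have zD : ∫ x, ∑ k, pderiv k (FD k) x = 0 := by
    rw [integral_finsetSum _ fun k _ => integrable_pderiv (sD k) (cD k) k]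
    exact Finset.sum_eq_zero fun k _ => integral_pderiv_eq_zero (sD k) (cD k) k
  have i1 : Integrable (fun x => -(∑ i, pderiv i (FA i) x)) := iA.neg
  have i12 : Integrable (fun x => -(∑ i, pderiv i (FA i) x) + ∑ j, pderiv j (FB j) x) := i1.add iB
  have i3 : Integrable (fun x => 2⁻¹ * ∑ i, pderiv i (FC i) x) := iC.const_mul _
  have i123 : Integrable (fun x => -(∑ i, pderiv i (FA i) x) + (∑ j, pderiv j (FB j) x) -
      2⁻¹ * ∑ i, pderiv i (FC i) x) := i12.sub i3
  have i4 : Integrable (fun x => 2⁻¹ * ∑ k, pderiv k (FD k) x) := iD.const_mul _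
  have iAdiv : Integrable Adiv := i123.add i4
  have zAdiv : ∫ x, Adiv x = 0 := by
    simp only [hAdiv]
    rw [integral_add i123 i4, integral_sub i12 i3, integral_add i1 iB, integral_neg,
      integral_const_mul, integral_const_mul, zA, zB, zC, zD]
    ring
  -- the pointwise identity and the integrability of both sides
  have hpt : ∀ x, ψ x * c.epair u X (c.vel u X) (c.divFlux u X) x = Adiv x + c.lowerOrder ψ u X x := by
    intro x
    rw [mul_epair_vel_divFlux_eq c hψ hu hX x, hAdiv]
  have ilhs : Integrable fun x => ψ x * c.epair u X (c.vel u X) (c.divFlux u X) x :=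
    (hψ.continuous.mul (continuous_epair c hu hX (contDiff_vel c hu hX)
      (contDiff_divFlux c hu hX))).integrable_of_hasCompactSupport hψc.mul_right
  have ilot : Integrable (c.lowerOrder ψ u X) := by
    have h : c.lowerOrder ψ u X = fun x =>
        ψ x * c.epair u X (c.vel u X) (c.divFlux u X) x - Adiv x := by
      funext x; rw [hpt x]; ring
    rw [h]
    exact ilhs.sub iAdiv
  calc ∫ x, ψ x * c.epair u X (c.vel u X) (c.divFlux u X) x
      = ∫ x, (Adiv x + c.lowerOrder ψ u X x) := integral_congr_ae (ae_of_all _ hpt)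
    _ = (∫ x, Adiv x) + ∫ x, c.lowerOrder ψ u X x := integral_add iAdiv ilot
    _ = ∫ x, c.lowerOrder ψ u X x := by rw [zAdiv, zero_add]

/-- **Integrability of the lower-order expression** (it is continuous and vanishes off the
support of `ψ`; here obtained as the difference of the two sides of the identity). [folklore] -/
theorem integrable_lowerOrder (c : SliceCoeff) {ψ u X : 𝔼 → ℝ} (hψ : ContDiff ℝ ∞ ψ)
    (hψc : HasCompactSupport ψ) (hu : ContDiff ℝ ∞ u) (hX : ContDiff ℝ ∞ X) :
    Integrable (c.lowerOrder ψ u X) := by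
  -- `lowerOrder` vanishes outside `tsupport ψ`, where `ψ`, `∂ψ` and the derivatives of `ψ·(coeff)`
  -- vanish; and it is continuous
  have hinf : (∞ : WithTop ℕ∞) ≠ 0 := by simp
  have hcont : Continuous (c.lowerOrder ψ u X) := by
    unfold lowerOrder
    have cV := (contDiff_vel c hu hX).continuous
    have cW := fun i => (contDiff_flux c hu hX i).continuous
    have cp := fun i => (contDiff_pderiv hu i).continuous
    have cdψ := fun i => continuous_pderiv hψ hinf i
    have cda := fun i => continuous_pderiv c.contDiff_a hinf i
    have cdb := fun i k => continuous_pderiv (c.contDiff_b k) hinf i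
    have cdg := fun k i j => continuous_pderiv (c.contDiff_g i j) hinf k
    have cE := fun j => continuous_pderiv (hψ.mul (c.contDiff_b j)) hinf j
    have cE' := fun i => continuous_pderiv ((hψ.mul c.contDiff_a).mul (c.contDiff_b i)) hinf i
    have cS := (contDiff_bgrad c hu).continuous
    have cQ := (contDiff_gquad c hu).continuous
    have cψ := hψ.continuous
    have ca := c.contDiff_a.continuous
    have cb := fun i => (c.contDiff_b i).continuous
    have cg := fun i j => (c.contDiff_g i j).continuous
    fun_prop
  refine hcont.integrable_of_hasCompactSupport ?_
  refine HasCompactSupport.of_support_subset_isCompact hψc.isCompact fun x hx => ?_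
  -- if `x ∉ tsupport ψ` then everything built from `ψ` vanishes at `x`
  by_contra hxK
  apply hx
  have hψ0 : ψ x = 0 := image_eq_zero_of_notMem_tsupport hxK
  have hdψ0 : ∀ i, pderiv i ψ x = 0 := fun i => by
    rw [pderiv_apply, fderiv_of_notMem_tsupport ℝ hxK]; rfl
  have hprod : ∀ (f : 𝔼 → ℝ) (i : Fin 3), pderiv i (fun z => ψ z * f z) x = 0 := by
    intro f i
    have hxK' : x ∉ tsupport fun z => ψ z * f z := fun h => hxK (tsupport_mul_subset_left h)
    rw [pderiv_apply, fderiv_of_notMem_tsupport ℝ hxK']; rfl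
  have hprod' : ∀ i, pderiv i (fun z => ψ z * c.a z * c.b i z) x = 0 := fun i => by
    have h : (fun z => ψ z * c.a z * c.b i z) = fun z => ψ z * (c.a z * c.b i z) := by
      funext z; ring
    rw [h]; exact hprod _ i
  simp only [lowerOrder, hψ0, hdψ0, hprod, hprod', zero_mul, mul_zero, Finset.sum_const_zero,
    sub_zero, add_zero]

/-! ### The bound on the lower-order expression -/

set_option maxHeartbeats 800000 in
/-- **Pointwise bound for the lower-order expression**: if at the point `x` the weight, the
coefficients and their first derivatives are bounded by `M ≥ 1` and `a x ≥ a₀ > 0`, then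
`|lowerOrder ψ u X (x)| ≤ 360 M⁵ (1 + a₀⁻¹)² (X(x)² + ∑ᵢ (∂ᵢu(x))²)` (a crude but explicit
constant; only its form — polynomial in the bounds, uniform in `u, X` — matters).
[cite: Hormander1997, §6.3 (6.3.7)] -/
theorem abs_lowerOrder_le (c : SliceCoeff) {ψ u X : 𝔼 → ℝ} (hψ : ContDiff ℝ ∞ ψ) {x : 𝔼}
    {M a₀ : ℝ} (hM : 1 ≤ M) (ha₀ : 0 < a₀) (ha₀x : a₀ ≤ c.a x)
    (hψM : |ψ x| ≤ M) (hdψ : ∀ i, |pderiv i ψ x| ≤ M)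
    (haM : |c.a x| ≤ M) (hda : ∀ i, |pderiv i c.a x| ≤ M)
    (hbM : ∀ i, |c.b i x| ≤ M) (hdb : ∀ i k, |pderiv i (c.b k) x| ≤ M)
    (hgM : ∀ i j, |c.g i j x| ≤ M) (hdg : ∀ k i j, |pderiv k (c.g i j) x| ≤ M) :
    |c.lowerOrder ψ u X x| ≤
      360 * M ^ 5 * (1 + a₀⁻¹) ^ 2 * (X x ^ 2 + ∑ i, pderiv i u x ^ 2) := by
  have hinf : (∞ : WithTop ℕ∞) ≠ 0 := by simp
  have dψ : Differentiable ℝ ψ := hψ.differentiable hinf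
  have da : Differentiable ℝ c.a := c.contDiff_a.differentiable hinf
  have db : ∀ i, Differentiable ℝ (c.b i) := fun i => (c.contDiff_b i).differentiable hinf
  -- sizes
  set p : Fin 3 → ℝ := fun i => pderiv i u x with hp
  set r : ℝ := |X x| + ∑ i, |p i| with hr
  set A : ℝ := 1 + a₀⁻¹ with hA
  have hM0 : 0 ≤ M := zero_le_one.trans hM
  have ha₀inv : 0 < a₀⁻¹ := inv_pos.2 ha₀
  have hA1 : 1 ≤ A := by rw [hA]; linarith
  have hA0 : 0 ≤ A := zero_le_one.trans hA1
  have hinvA : a₀⁻¹ ≤ A := by rw [hA]; linarith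
  have hsum0 : 0 ≤ ∑ i, |p i| := Finset.sum_nonneg fun i _ => abs_nonneg _
  have hr0 : 0 ≤ r := add_nonneg (abs_nonneg _) hsum0
  have hXr : |X x| ≤ r := le_add_of_nonneg_right hsum0
  have hpr : ∀ i, |p i| ≤ r := fun i =>
    (Finset.single_le_sum (fun j _ => abs_nonneg (p j)) (Finset.mem_univ i)).trans
      (le_add_of_nonneg_left (abs_nonneg _))
  have hsumr : ∑ i, |p i| ≤ r := le_add_of_nonneg_left (abs_nonneg _)
  have hax0 : 0 < c.a x := c.a_pos x
  -- powers of `M`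
  have hMA : 1 ≤ M * A := one_le_mul_of_one_le_of_one_le hM hA1
  have hM2A : 1 ≤ M ^ 2 * A := one_le_mul_of_one_le_of_one_le (one_le_pow₀ hM) hA1
  have hM2A2 : 1 ≤ M ^ 2 * A ^ 2 :=
    one_le_mul_of_one_le_of_one_le (one_le_pow₀ hM) (one_le_pow₀ hA1)
  have hK3A : M ^ 3 * A ≤ M ^ 5 * A ^ 2 := by
    have h : M ^ 5 * A ^ 2 = M ^ 3 * A * (M ^ 2 * A) := by ring
    rw [h]; exact le_mul_of_one_le_right (by positivity) hM2A
  have hK4A : M ^ 4 * A ≤ M ^ 5 * A ^ 2 := by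
    have h : M ^ 5 * A ^ 2 = M ^ 4 * A * (M * A) := by ring
    rw [h]; exact le_mul_of_one_le_right (by positivity) hMA
  have hK3 : M ^ 3 ≤ M ^ 5 * A ^ 2 := by
    have h : M ^ 5 * A ^ 2 = M ^ 3 * (M ^ 2 * A ^ 2) := by ring
    rw [h]; exact le_mul_of_one_le_right (by positivity) hM2A2
  have hMr : r ≤ M * r := le_mul_of_one_le_left hr0 hM
  have hMAr : M * r ≤ M ^ 2 * A * r := by
    have h : M ^ 2 * A * r = M * r * (M * A) := by ring
    rw [h]; exact le_mul_of_one_le_right (by positivity) hMA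
  -- atom bounds
  have hS : |c.bgrad u x| ≤ M * r := by
    rw [bgrad_apply]
    calc |∑ i, c.b i x * pderiv i u x| ≤ ∑ i, |c.b i x * pderiv i u x| :=
          Finset.abs_sum_le_sum_abs _ _
      _ ≤ ∑ i, M * |p i| := Finset.sum_le_sum fun i _ => by
          rw [abs_mul]; exact mul_le_mul (hbM i) le_rfl (abs_nonneg _) hM0
      _ = M * ∑ i, |p i| := by rw [Finset.mul_sum]
      _ ≤ M * r := mul_le_mul_of_nonneg_left hsumr hM0
  have hV : |c.vel u X x| ≤ 2 * M * A * r := by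
    have h1 : |c.bgrad u x - X x| ≤ 2 * M * r := by
      calc |c.bgrad u x - X x| ≤ |c.bgrad u x| + |X x| := abs_sub _ _
        _ ≤ M * r + r := add_le_add hS hXr
        _ ≤ 2 * M * r := by linarith
    have h2Mr : 0 ≤ 2 * M * r := by positivity
    unfold vel
    rw [abs_div, abs_of_pos hax0]
    calc |c.bgrad u x - X x| / c.a x ≤ 2 * M * r / c.a x :=
          div_le_div_of_nonneg_right h1 hax0.le
      _ ≤ 2 * M * r / a₀ := div_le_div_of_nonneg_left h2Mr ha₀ ha₀x
      _ = 2 * M * r * a₀⁻¹ := div_eq_mul_inv _ _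
      _ ≤ 2 * M * r * A := mul_le_mul_of_nonneg_left hinvA h2Mr
      _ = 2 * M * A * r := by ring
  have hVA : |c.vel u X x| ≤ 2 * M * A * r := hV
  have hGp : ∀ i, |∑ j, c.g i j x * pderiv j u x| ≤ M * r := by
    intro i
    calc |∑ j, c.g i j x * pderiv j u x| ≤ ∑ j, |c.g i j x * pderiv j u x| :=
          Finset.abs_sum_le_sum_abs _ _
      _ ≤ ∑ j, M * |p j| := Finset.sum_le_sum fun j _ => by
          rw [abs_mul]; exact mul_le_mul (hgM i j) le_rfl (abs_nonneg _) hM0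
      _ = M * ∑ j, |p j| := by rw [Finset.mul_sum]
      _ ≤ M * r := mul_le_mul_of_nonneg_left hsumr hM0
  have hW : ∀ i, |c.flux u X i x| ≤ 3 * M ^ 2 * A * r := by
    intro i
    rw [flux_apply]
    calc |c.b i x * c.vel u X x + ∑ j, c.g i j x * pderiv j u x|
        ≤ |c.b i x * c.vel u X x| + |∑ j, c.g i j x * pderiv j u x| := abs_add_le _ _
      _ ≤ M * (2 * M * A * r) + M * r := by
          rw [abs_mul]
          exact add_le_add (mul_le_mul (hbM i) hV (abs_nonneg _) hM0) (hGp i)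
      _ ≤ 3 * M ^ 2 * A * r := by linarith
  have hQ : |c.gquad u x| ≤ M * r ^ 2 := by
    rw [gquad_apply]
    calc |∑ i, ∑ j, c.g i j x * pderiv i u x * pderiv j u x|
        ≤ ∑ i, |∑ j, c.g i j x * pderiv i u x * pderiv j u x| := Finset.abs_sum_le_sum_abs _ _
      _ ≤ ∑ i, ∑ j, |c.g i j x * pderiv i u x * pderiv j u x| :=
          Finset.sum_le_sum fun i _ => Finset.abs_sum_le_sum_abs _ _
      _ ≤ ∑ i, ∑ j, M * (|p i| * |p j|) := Finset.sum_le_sum fun i _ =>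
          Finset.sum_le_sum fun j _ => by
            rw [abs_mul, abs_mul, mul_assoc]
            exact mul_le_mul (hgM i j) le_rfl (by positivity) hM0
      _ = M * ((∑ i, |p i|) * ∑ j, |p j|) := by
          rw [Finset.sum_mul_sum, Finset.mul_sum]
          refine Finset.sum_congr rfl fun i _ => ?_
          rw [Finset.mul_sum]
      _ ≤ M * (r * r) := mul_le_mul_of_nonneg_left
          (mul_le_mul hsumr hsumr hsum0 hr0) hM0
      _ = M * r ^ 2 := by ring
  have hE : ∀ j, |pderiv j (fun y => ψ y * c.b j y) x| ≤ 2 * M ^ 2 := by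
    intro j
    rw [pderiv_mul dψ (db j)]
    calc |pderiv j ψ x * c.b j x + ψ x * pderiv j (c.b j) x|
        ≤ |pderiv j ψ x * c.b j x| + |ψ x * pderiv j (c.b j) x| := abs_add_le _ _
      _ ≤ M * M + M * M := by
          rw [abs_mul, abs_mul]
          exact add_le_add (mul_le_mul (hdψ j) (hbM j) (abs_nonneg _) hM0)
            (mul_le_mul hψM (hdb j j) (abs_nonneg _) hM0)
      _ = 2 * M ^ 2 := by ring
  have hE' : ∀ i, |pderiv i (fun y => ψ y * c.a y * c.b i y) x| ≤ 3 * M ^ 3 := by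
    intro i
    rw [pderiv_mul (dψ.fun_mul da) (db i), pderiv_mul dψ da]
    calc |(pderiv i ψ x * c.a x + ψ x * pderiv i c.a x) * c.b i x +
          ψ x * c.a x * pderiv i (c.b i) x|
        ≤ |(pderiv i ψ x * c.a x + ψ x * pderiv i c.a x) * c.b i x| +
            |ψ x * c.a x * pderiv i (c.b i) x| := abs_add_le _ _
      _ ≤ (M * M + M * M) * M + M * M * M := by
          rw [abs_mul, abs_mul, abs_mul]
          refine add_le_add (mul_le_mul ?_ (hbM i) (abs_nonneg _) (by positivity))
            (mul_le_mul (mul_le_mul hψM haM (abs_nonneg _) hM0) (hdb i i) (abs_nonneg _)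
              (by positivity))
          calc |pderiv i ψ x * c.a x + ψ x * pderiv i c.a x|
              ≤ |pderiv i ψ x * c.a x| + |ψ x * pderiv i c.a x| := abs_add_le _ _
            _ ≤ M * M + M * M := by
                rw [abs_mul, abs_mul]
                exact add_le_add (mul_le_mul (hdψ i) haM (abs_nonneg _) hM0)
                  (mul_le_mul hψM (hda i) (abs_nonneg _) hM0)
      _ = 3 * M ^ 3 := by ring
  have hdbp : ∀ i, |∑ k, pderiv i (c.b k) x * pderiv k u x| ≤ M * r := by
    intro i
    calc |∑ k, pderiv i (c.b k) x * pderiv k u x| ≤ ∑ k, |pderiv i (c.b k) x * pderiv k u x| :=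
          Finset.abs_sum_le_sum_abs _ _
      _ ≤ ∑ k, M * |p k| := Finset.sum_le_sum fun k _ => by
          rw [abs_mul]; exact mul_le_mul (hdb i k) le_rfl (abs_nonneg _) hM0
      _ = M * ∑ k, |p k| := by rw [Finset.mul_sum]
      _ ≤ M * r := mul_le_mul_of_nonneg_left hsumr hM0
  -- the seven terms
  set T1 : ℝ := ∑ i, pderiv i ψ x * X x * c.flux u X i x with hT1
  set T2 : ℝ := ψ x * ∑ i, ((∑ k, pderiv i (c.b k) x * pderiv k u x) -
    pderiv i c.a x * c.vel u X x) * c.flux u X i x with hT2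
  set T3 : ℝ := (∑ j, pderiv j (fun y => ψ y * c.b j y) x) * (c.vel u X x * c.bgrad u x) with hT3
  set T4 : ℝ := ψ x * c.vel u X x * (∑ i, ∑ j, c.b j x * pderiv j (c.b i) x * pderiv i u x)
    with hT4
  set T5 : ℝ := 2⁻¹ * (∑ i, pderiv i (fun y => ψ y * c.a y * c.b i y) x) * c.vel u X x ^ 2
    with hT5
  set T6 : ℝ := 2⁻¹ * (∑ k, pderiv k (fun y => ψ y * c.b k y) x) * c.gquad u x with hT6
  set T7 : ℝ := 2⁻¹ * ψ x * ∑ k, c.b k x * ∑ i, ∑ j, pderiv k (c.g i j) x * pderiv i u x *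
    pderiv j u x with hT7
  have hlot : c.lowerOrder ψ u X x = T1 + T2 - T3 - T4 + T5 - T6 - T7 := by
    rw [hT1, hT2, hT3, hT4, hT5, hT6, hT7]; rfl
  have K : 0 ≤ M ^ 5 * A ^ 2 * r ^ 2 := by positivity
  have b1 : |T1| ≤ 9 * (M ^ 5 * A ^ 2 * r ^ 2) := by
    calc |T1| ≤ ∑ i, |pderiv i ψ x * X x * c.flux u X i x| := Finset.abs_sum_le_sum_abs _ _
      _ ≤ ∑ _i : Fin 3, M * r * (3 * M ^ 2 * A * r) := Finset.sum_le_sum fun i _ => by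
          rw [abs_mul, abs_mul]
          exact mul_le_mul (mul_le_mul (hdψ i) hXr (abs_nonneg _) hM0) (hW i) (abs_nonneg _)
            (by positivity)
      _ = 9 * (M ^ 3 * A * r ^ 2) := by
          simp only [Finset.sum_const, Finset.card_univ, Fintype.card_fin, nsmul_eq_mul]
          push_cast; ring
      _ ≤ 9 * (M ^ 5 * A ^ 2 * r ^ 2) := by
          have h : M ^ 3 * A * r ^ 2 ≤ M ^ 5 * A ^ 2 * r ^ 2 :=
            mul_le_mul_of_nonneg_right hK3A (sq_nonneg _)
          linarith
  have b2 : |T2| ≤ 27 * (M ^ 5 * A ^ 2 * r ^ 2) := by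
    have hin : ∀ i, |((∑ k, pderiv i (c.b k) x * pderiv k u x) - pderiv i c.a x * c.vel u X x) *
        c.flux u X i x| ≤ (3 * M ^ 2 * A * r) * (3 * M ^ 2 * A * r) := by
      intro i
      rw [abs_mul]
      refine mul_le_mul ?_ (hW i) (abs_nonneg _) (by positivity)
      calc |(∑ k, pderiv i (c.b k) x * pderiv k u x) - pderiv i c.a x * c.vel u X x|
          ≤ |∑ k, pderiv i (c.b k) x * pderiv k u x| + |pderiv i c.a x * c.vel u X x| :=
            abs_sub _ _
        _ ≤ M * r + M * (2 * M * A * r) := by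
            rw [abs_mul]
            exact add_le_add (hdbp i) (mul_le_mul (hda i) hV (abs_nonneg _) hM0)
        _ ≤ 3 * M ^ 2 * A * r := by linarith
    calc |T2| = |ψ x| * |∑ i, ((∑ k, pderiv i (c.b k) x * pderiv k u x) -
          pderiv i c.a x * c.vel u X x) * c.flux u X i x| := abs_mul _ _
      _ ≤ M * ∑ _i : Fin 3, (3 * M ^ 2 * A * r) * (3 * M ^ 2 * A * r) :=
          mul_le_mul hψM ((Finset.abs_sum_le_sum_abs _ _).trans (Finset.sum_le_sum fun i _ =>
            hin i)) (abs_nonneg _) hM0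
      _ = 27 * (M ^ 5 * A ^ 2 * r ^ 2) := by
          simp only [Finset.sum_const, Finset.card_univ, Fintype.card_fin, nsmul_eq_mul]
          push_cast; ring
  have b3 : |T3| ≤ 12 * (M ^ 5 * A ^ 2 * r ^ 2) := by
    calc |T3| = |∑ j, pderiv j (fun y => ψ y * c.b j y) x| * (|c.vel u X x| * |c.bgrad u x|) := by
          rw [hT3, abs_mul, abs_mul]
      _ ≤ (∑ _j : Fin 3, 2 * M ^ 2) * ((2 * M * A * r) * (M * r)) :=
          mul_le_mul ((Finset.abs_sum_le_sum_abs _ _).trans (Finset.sum_le_sum fun j _ => hE j))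
            (mul_le_mul hV hS (abs_nonneg _) (by positivity)) (by positivity)
            (Finset.sum_nonneg fun _ _ => by positivity)
      _ = 12 * (M ^ 4 * A * r ^ 2) := by
          simp only [Finset.sum_const, Finset.card_univ, Fintype.card_fin, nsmul_eq_mul]
          push_cast; ring
      _ ≤ 12 * (M ^ 5 * A ^ 2 * r ^ 2) := by
          have h : M ^ 4 * A * r ^ 2 ≤ M ^ 5 * A ^ 2 * r ^ 2 :=
            mul_le_mul_of_nonneg_right hK4A (sq_nonneg _)
          linarith
  have b4 : |T4| ≤ 6 * (M ^ 5 * A ^ 2 * r ^ 2) := by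
    have hin : |∑ i, ∑ j, c.b j x * pderiv j (c.b i) x * pderiv i u x| ≤ 3 * M ^ 2 * r := by
      calc |∑ i, ∑ j, c.b j x * pderiv j (c.b i) x * pderiv i u x|
          ≤ ∑ i, ∑ j, |c.b j x * pderiv j (c.b i) x * pderiv i u x| :=
            (Finset.abs_sum_le_sum_abs _ _).trans
              (Finset.sum_le_sum fun i _ => Finset.abs_sum_le_sum_abs _ _)
        _ ≤ ∑ i, ∑ _j : Fin 3, M * M * |p i| := Finset.sum_le_sum fun i _ =>
            Finset.sum_le_sum fun j _ => by
              rw [abs_mul, abs_mul]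
              exact mul_le_mul (mul_le_mul (hbM j) (hdb j i) (abs_nonneg _) hM0) le_rfl
                (abs_nonneg _) (by positivity)
        _ = 3 * M ^ 2 * ∑ i, |p i| := by
            simp only [Finset.sum_const, Finset.card_univ, Fintype.card_fin, nsmul_eq_mul,
              Finset.mul_sum]
            refine Finset.sum_congr rfl fun i _ => ?_
            push_cast; ring
        _ ≤ 3 * M ^ 2 * r := mul_le_mul_of_nonneg_left hsumr (by positivity)
    calc |T4| = |ψ x| * |c.vel u X x| * |∑ i, ∑ j, c.b j x * pderiv j (c.b i) x * pderiv i u x| := by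
          rw [hT4, abs_mul, abs_mul]
      _ ≤ M * (2 * M * A * r) * (3 * M ^ 2 * r) :=
          mul_le_mul (mul_le_mul hψM hV (abs_nonneg _) hM0) hin (abs_nonneg _) (by positivity)
      _ = 6 * (M ^ 4 * A * r ^ 2) := by ring
      _ ≤ 6 * (M ^ 5 * A ^ 2 * r ^ 2) := by
          have h : M ^ 4 * A * r ^ 2 ≤ M ^ 5 * A ^ 2 * r ^ 2 :=
            mul_le_mul_of_nonneg_right hK4A (sq_nonneg _)
          linarith
  have b5 : |T5| ≤ 18 * (M ^ 5 * A ^ 2 * r ^ 2) := by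
    calc |T5| = 2⁻¹ * |∑ i, pderiv i (fun y => ψ y * c.a y * c.b i y) x| * |c.vel u X x| ^ 2 := by
          rw [hT5, abs_mul, abs_mul, abs_pow, abs_of_pos (by norm_num : (0:ℝ) < 2⁻¹)]
      _ ≤ 2⁻¹ * (∑ _i : Fin 3, 3 * M ^ 3) * (2 * M * A * r) ^ 2 := by
          refine mul_le_mul (mul_le_mul_of_nonneg_left ((Finset.abs_sum_le_sum_abs _ _).trans
            (Finset.sum_le_sum fun i _ => hE' i)) (by norm_num)) ?_ (by positivity)
            (by positivity)
          exact pow_le_pow_left₀ (abs_nonneg _) hV 2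
      _ = 18 * (M ^ 5 * A ^ 2 * r ^ 2) := by
          simp only [Finset.sum_const, Finset.card_univ, Fintype.card_fin, nsmul_eq_mul]
          push_cast; ring
  have b6 : |T6| ≤ 3 * (M ^ 5 * A ^ 2 * r ^ 2) := by
    calc |T6| = 2⁻¹ * |∑ k, pderiv k (fun y => ψ y * c.b k y) x| * |c.gquad u x| := by
          rw [hT6, abs_mul, abs_mul, abs_of_pos (by norm_num : (0:ℝ) < 2⁻¹)]
      _ ≤ 2⁻¹ * (∑ _k : Fin 3, 2 * M ^ 2) * (M * r ^ 2) :=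
          mul_le_mul (mul_le_mul_of_nonneg_left ((Finset.abs_sum_le_sum_abs _ _).trans
            (Finset.sum_le_sum fun k _ => hE k)) (by norm_num)) hQ (abs_nonneg _) (by positivity)
      _ = 3 * (M ^ 3 * r ^ 2) := by
          simp only [Finset.sum_const, Finset.card_univ, Fintype.card_fin, nsmul_eq_mul]
          push_cast; ring
      _ ≤ 3 * (M ^ 5 * A ^ 2 * r ^ 2) := by
          have h : M ^ 3 * r ^ 2 ≤ M ^ 5 * A ^ 2 * r ^ 2 :=
            mul_le_mul_of_nonneg_right hK3 (sq_nonneg _)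
          linarith
  have b7 : |T7| ≤ 2 * (M ^ 5 * A ^ 2 * r ^ 2) := by
    have hin : ∀ k, |∑ i, ∑ j, pderiv k (c.g i j) x * pderiv i u x * pderiv j u x| ≤ M * r ^ 2 := by
      intro k
      calc |∑ i, ∑ j, pderiv k (c.g i j) x * pderiv i u x * pderiv j u x|
          ≤ ∑ i, ∑ j, |pderiv k (c.g i j) x * pderiv i u x * pderiv j u x| :=
            (Finset.abs_sum_le_sum_abs _ _).trans
              (Finset.sum_le_sum fun i _ => Finset.abs_sum_le_sum_abs _ _)
        _ ≤ ∑ i, ∑ j, M * (|p i| * |p j|) := Finset.sum_le_sum fun i _ =>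
            Finset.sum_le_sum fun j _ => by
              rw [abs_mul, abs_mul, mul_assoc]
              exact mul_le_mul (hdg k i j) le_rfl (by positivity) hM0
        _ = M * ((∑ i, |p i|) * ∑ j, |p j|) := by
            rw [Finset.sum_mul_sum, Finset.mul_sum]
            refine Finset.sum_congr rfl fun i _ => ?_
            rw [Finset.mul_sum]
        _ ≤ M * (r * r) := mul_le_mul_of_nonneg_left (mul_le_mul hsumr hsumr hsum0 hr0) hM0
        _ = M * r ^ 2 := by ring
    have hin2 : |∑ k, c.b k x * ∑ i, ∑ j, pderiv k (c.g i j) x * pderiv i u x * pderiv j u x| ≤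
        3 * (M * (M * r ^ 2)) := by
      calc |∑ k, c.b k x * ∑ i, ∑ j, pderiv k (c.g i j) x * pderiv i u x * pderiv j u x|
          ≤ ∑ k, |c.b k x * ∑ i, ∑ j, pderiv k (c.g i j) x * pderiv i u x * pderiv j u x| :=
            Finset.abs_sum_le_sum_abs _ _
        _ ≤ ∑ _k : Fin 3, M * (M * r ^ 2) := Finset.sum_le_sum fun k _ => by
            rw [abs_mul]; exact mul_le_mul (hbM k) (hin k) (abs_nonneg _) hM0
        _ = 3 * (M * (M * r ^ 2)) := by
            simp only [Finset.sum_const, Finset.card_univ, Fintype.card_fin, nsmul_eq_mul]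
            push_cast; ring
    calc |T7| = 2⁻¹ * |ψ x| *
          |∑ k, c.b k x * ∑ i, ∑ j, pderiv k (c.g i j) x * pderiv i u x * pderiv j u x| := by
          rw [hT7, abs_mul, abs_mul, abs_of_pos (by norm_num : (0:ℝ) < 2⁻¹)]
      _ ≤ 2⁻¹ * M * (3 * (M * (M * r ^ 2))) :=
          mul_le_mul (mul_le_mul_of_nonneg_left hψM (by norm_num)) hin2 (abs_nonneg _)
            (by positivity)
      _ = (3 / 2) * (M ^ 3 * r ^ 2) := by ring
      _ ≤ 2 * (M ^ 5 * A ^ 2 * r ^ 2) := by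
          have h : M ^ 3 * r ^ 2 ≤ M ^ 5 * A ^ 2 * r ^ 2 :=
            mul_le_mul_of_nonneg_right hK3 (sq_nonneg _)
          linarith
  -- assemble
  have habs : |c.lowerOrder ψ u X x| ≤ 77 * (M ^ 5 * A ^ 2 * r ^ 2) := by
    rw [hlot]
    have e1 := abs_add_le T1 T2
    have e2 := abs_sub (T1 + T2) T3
    have e3 := abs_sub (T1 + T2 - T3) T4
    have e4 := abs_add_le (T1 + T2 - T3 - T4) T5
    have e5 := abs_sub (T1 + T2 - T3 - T4 + T5) T6
    have e6 := abs_sub (T1 + T2 - T3 - T4 + T5 - T6) T7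
    linarith
  -- `r² ≤ 4 (X² + ∑ pᵢ²)`
  have hr2 : r ^ 2 ≤ 4 * (X x ^ 2 + ∑ i, pderiv i u x ^ 2) := by
    have hexp : r = |X x| + |p 0| + |p 1| + |p 2| := by
      rw [hr, Fin.sum_univ_three]; ring
    have h4 : (|X x| + |p 0| + |p 1| + |p 2|) ^ 2 ≤
        4 * (|X x| ^ 2 + |p 0| ^ 2 + |p 1| ^ 2 + |p 2| ^ 2) := by
      nlinarith [sq_nonneg (|X x| - |p 0|), sq_nonneg (|X x| - |p 1|), sq_nonneg (|X x| - |p 2|),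
        sq_nonneg (|p 0| - |p 1|), sq_nonneg (|p 0| - |p 2|), sq_nonneg (|p 1| - |p 2|)]
    rw [← hexp, sq_abs, sq_abs, sq_abs, sq_abs] at h4
    simpa [Fin.sum_univ_three, hp, add_assoc] using h4
  have h0 : 0 ≤ X x ^ 2 + ∑ i, pderiv i u x ^ 2 :=
    add_nonneg (sq_nonneg _) (Finset.sum_nonneg fun _ _ => sq_nonneg _)
  calc |c.lowerOrder ψ u X x| ≤ 77 * (M ^ 5 * A ^ 2 * r ^ 2) := habs
    _ = 77 * (M ^ 5 * A ^ 2) * r ^ 2 := by ring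
    _ ≤ 77 * (M ^ 5 * A ^ 2) * (4 * (X x ^ 2 + ∑ i, pderiv i u x ^ 2)) :=
        mul_le_mul_of_nonneg_left hr2 (by positivity)
    _ = 308 * (M ^ 5 * A ^ 2 * (X x ^ 2 + ∑ i, pderiv i u x ^ 2)) := by ring
    _ ≤ 360 * (M ^ 5 * A ^ 2 * (X x ^ 2 + ∑ i, pderiv i u x ^ 2)) :=
        mul_le_mul_of_nonneg_right (by norm_num) (by positivity)
    _ = 360 * M ^ 5 * A ^ 2 * (X x ^ 2 + ∑ i, pderiv i u x ^ 2) := by ring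

end SliceCoeff

end Literature.Analysis.PDE

end
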